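/-
Copyright (c) 2026 the pub-hodgecm-mathlib formalisation cell (harness21).  Prover seat hodgecm-mathlib-LH7-p02 (g6): LH4-plan (g6) WORD #78 price-list item (P8a)
«(D-RAM) DYADIC DOCKINGS» (LH5-p01 (g5) census `CENSUS-DRAM-h2.v1` sha16 3989fe6bdd514291, §3 (d1)(d2)); 2026-09-02.
-/
import Mathlib.LinearAlgebra.Matrix.Trace
import Mathlib.LinearAlgebra.Matrix.Determinant.Basic
import Literature.NumberTheory.LocalFields.CompleteValuedSquareRootNearOne   -- ★ `exists_mul_self_eq_of_valued_sub_one_lt_four` (strong Hensel for `X² − s` at `1`, any residue characteristic) + the `K_v` instance datum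
import HarnessLib

/-!
# Dyadic dockings at a ramified place: the exact depth of the Hensel square root, and the centre depth `|tr A − 2u| = |2|·μ`

Topic `NumberTheory/NumberFields`; namespace `Literature.NumberTheory.NumberFields`.  THEOREMS ONLY (no definition, no instance, no notation, no named fact,
no `sorry`); CM-free and generic (`[Valued K ℤᵐ⁰]`); kernel lane `--supports stmt-HodgeConjecture-24833`.  Cell `pub/hodgecm-mathlib` (D-0151), crux H413 =
`stmt-HodgeConjecture-24833`; half A line LH4 (dyadic pay-down), LH4-plan (g6) WORD #78 price list, item **(P8a)** = the two «cheap bankable dockings» (d1)(d2) of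
LH5-p01 (g5)'s (D-RAM) `h2` census (§3): the `|2|`-carrying forms of two sockets of the ramified type-(2) rows, i.e. what a dyadic twin of those rows reads in place
of their `|2|_w = 1` specialisations.  HONEST LABEL: HC_CM is proved only modulo the 7 printed citations (2 remaining named inputs: hLiu418 =
stmt-HodgeConjecture-24832, h413 = stmt-HodgeConjecture-24833) until rung 0 closes; this file is count-neutral ((D-RAM) stays PRINT; pays no organ, opens no road).

DEDUP (census-first, recorded on the LH4 bus): the literal (d1) «re-export ★ `QuaternionAlgebra.exists_sq_eq_of_valued_sub_one_lt` at `w.1.adicCompletion L`» is NOT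
typed — ★ `Automorphic/QuaternionLocalRamifiedTraceAdjust` (`∃ β, β² = u ∧ |2|·|β − 1| ≤ |u − 1|` under `|u − 1| < |4|`) and ★
`LocalFields/CompleteValuedSquareRootNearOne` (`∃ r, r·r = s ∧ |r − 1| < |2|`, generic + `K_v`) already serve that socket verbatim at `K := L`, `v := w.1`.  What this
file adds is the EXACT depth bookkeeping both leave implicit, and the `h2`-free form of the centre-depth lemma K9.

* §1 (d2) **THE CENTRE IS `|2|·μ`-DEEP** (dyadic form of ★ K9 `UnitaryLatticeTree.v_trace_sub_two_mul_eq_of_v_det_sub_smul_one_eq_of_disc_lt`, which is the reading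
  `|2| = 1` of the head below and is cited, not restated): the `2 × 2` identity `(tr A − 2u)² = 4·det(A − u·1) + (tr² A − 4 det A)` over any commutative ring
  (`trace_sub_two_mul_sq_eq`), hence `|tr² A − 4 det A| < |4·det(A − u·1)| ⇒ |(tr A − 2u)²| = |4|·|det(A − u·1)|` (`valued_trace_sub_two_mul_sq_eq_of_disc_lt`) and, with
  `|det(A − u·1)| = μ²`, **`|tr A − 2u| = |2|·μ`** (`valued_trace_sub_two_mul_eq_valued_two_mul_of_disc_lt`) — the census flag (F4): the centre-depth token acquires
  `|2|_w = |ϖ_w|^{e_w}`.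
* §2 (d1)′ **THE HENSEL ROOT HAS DEPTH EXACTLY `|t − 1| ∕ |2|`**: for `r² = t` with `|r − 1| < |2|` one has `|r + 1| = |2|` (`valued_add_one_eq_valued_two_of_valued_sub_one_lt`),
  `|2|·|r − 1| = |t − 1|` (`valued_two_mul_valued_sub_one_eq_of_sq_eq`), the other root sits at depth exactly `|2|` (`valued_neg_sub_one_eq_valued_two`), and the root with
  `|r − 1| < |2|` is UNIQUE (`eq_of_sq_eq_sq_of_valued_sub_one_lt`) — pure valuation algebra, no completeness; with ★ strong Hensel:
  **`exists_sq_eq_and_valued_sub_one_eq_of_valued_sub_one_lt_four`** (`|t − 1| < |4| ⇒ ∃ r, r² = t ∧ |r − 1| < |2| ∧ |2|·|r − 1| = |t − 1|`, any `K` with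
  `𝓂[K]`-adically complete `𝒪[K]`) and its instantiation `…_adicCompletion` at `K_v` for a number field `K` and ANY finite place `v` (the rows' `hsq` socket at
  `K := L`, `v := w.1`, now with the depth clause).

## References
* [Omeara1963] O. T. O'Meara, *Introduction to Quadratic Forms*, Grundlehren 117 (1963), §63A: 63:1 (local square theorem), 63:8 (`1 + 4𝔭 ⊆ (𝒪^×)²` at a dyadic place).
* [Serre1979] J.-P. Serre, *Local Fields*, GTM 67 (1979), Ch. XIV §4 (squares among one-units), Ch. II §4 Prop. 7 (Hensel).
* [Kottwitz1986] R. E. Kottwitz, *Base change for unit elements of Hecke algebras*, Compositio Math. 60 (1986), §3 (depth of the centre of a `2 × 2` block).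
* [Rogawski1990] J. D. Rogawski, *Automorphic Representations of Unitary Groups in Three Variables*, Ann. of Math. Stud. 123 (1990), §4.9 p. 55.
-/

set_option autoImplicit false

noncomputable section

open scoped Valued WithZero
open NumberField IsDedekindDomain Matrix

namespace Literature.NumberTheory.NumberFields

/-! ## §1 (d2) The centre of a `2 × 2` block is `|2|·μ`-deep -/

/-- **The `2 × 2` identity** `(tr A − 2u)² = 4·det(A − u·1) + (tr² A − 4 det A)` over any commutative ring (complete the square in the characteristic
polynomial `det(A − u·1) = u² − (tr A)·u + det A`). [cite: Kottwitz1986, §3] [cite: Rogawski1990, §4.9 p. 55] -/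
theorem trace_sub_two_mul_sq_eq {R : Type*} [CommRing R] (A : Matrix (Fin 2) (Fin 2) R) (u : R) :
    (A.trace - 2 * u) ^ 2 = 4 * (A - u • (1 : Matrix (Fin 2) (Fin 2) R)).det + (A.trace ^ 2 - 4 * A.det) := by
  simp only [Matrix.det_fin_two, Matrix.trace_fin_two, Matrix.sub_apply, Matrix.smul_apply, Matrix.one_apply_eq,
    Matrix.one_apply_ne (by decide : (0 : Fin 2) ≠ 1), Matrix.one_apply_ne (by decide : (1 : Fin 2) ≠ 0), smul_eq_mul,
    mul_one, mul_zero, sub_zero]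
  ring

/-- **Squared centre depth, `h2`-free**: if the traceless part is deeper than `4·det(A − u·1)`, i.e. `|tr² A − 4 det A| < |4·det(A − u·1)|`, then
`|(tr A − 2u)²| = |4|·|det(A − u·1)|` (ultrametric reading of ★ `trace_sub_two_mul_sq_eq`). [cite: Kottwitz1986, §3] [cite: Rogawski1990, §4.9 p. 55] -/
theorem valued_trace_sub_two_mul_sq_eq_of_disc_lt {K : Type*} [Field K] [Valued K ℤᵐ⁰] (A : Matrix (Fin 2) (Fin 2) K) (u : K)
    (hdisc : Valued.v (A.trace ^ 2 - 4 * A.det) < Valued.v (4 * (A - u • (1 : Matrix (Fin 2) (Fin 2) K)).det)) :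
    Valued.v ((A.trace - 2 * u) ^ 2) = Valued.v (4 : K) * Valued.v (A - u • (1 : Matrix (Fin 2) (Fin 2) K)).det := by
  rw [trace_sub_two_mul_sq_eq, Valuation.map_add_eq_of_lt_left _ hdisc, map_mul]

/-- In `ℤᵐ⁰`, `x·x = y·y ⇒ x = y` (order argument; `ℤᵐ⁰` has a zero, so plain cancellation does not apply). [folklore] -/
private theorem eq_of_mul_self_eq_mul_self_withZero {x y : ℤᵐ⁰} (h : x * x = y * y) : x = y := by
  -- adapted from ★ `Rogawski1990/DepthZeroKappaTransferTypeTwoRamifiedAnisotropicCellZeroB` (private there)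
  rcases lt_trichotomy x y with hlt | heq | hgt
  · exact absurd h (ne_of_lt (lt_of_le_of_lt (mul_le_mul' le_rfl hlt.le)
      (mul_lt_mul_of_pos_right hlt (lt_of_le_of_lt zero_le hlt))))
  · exact heq
  · exact absurd h.symm (ne_of_lt (lt_of_le_of_lt (mul_le_mul' le_rfl hgt.le)
      (mul_lt_mul_of_pos_right hgt (lt_of_le_of_lt zero_le hgt))))

/-- **THE CENTRE IS `|2|·μ`-DEEP** (dyadic form of ★ K9 `UnitaryLatticeTree.v_trace_sub_two_mul_eq_of_v_det_sub_smul_one_eq_of_disc_lt`, whose `|2| = 1` reading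
it is): for a `2 × 2` matrix `A` and a scalar `u` with `|det(A − u·1)| = μ²` and `|tr² A − 4 det A| < |4|·μ²`, `|tr A − 2u| = |2|·μ`.  At a ramified dyadic place
`|2|_w = |ϖ_w|^{e_w}`, `e_w = 2·ord_v 2`: the centre-depth token of the type-(2) rows shifts by `e_w` (census flag (F4)). [cite: Kottwitz1986, §3] [cite: Rogawski1990, §4.9 p. 55] -/
theorem valued_trace_sub_two_mul_eq_valued_two_mul_of_disc_lt {K : Type*} [Field K] [Valued K ℤᵐ⁰] (A : Matrix (Fin 2) (Fin 2) K) (u : K) {μ : ℤᵐ⁰}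
    (hdet : Valued.v (A - u • (1 : Matrix (Fin 2) (Fin 2) K)).det = μ * μ) (hdisc : Valued.v (A.trace ^ 2 - 4 * A.det) < Valued.v (4 : K) * (μ * μ)) :
    Valued.v (A.trace - 2 * u) = Valued.v (2 : K) * μ := by
  have h4 : Valued.v (4 * (A - u • (1 : Matrix (Fin 2) (Fin 2) K)).det) = Valued.v (4 : K) * (μ * μ) := by rw [map_mul, hdet]
  rw [← h4] at hdisc
  have hsq := valued_trace_sub_two_mul_sq_eq_of_disc_lt A u hdisc
  rw [map_pow, hdet, show (4 : K) = 2 * 2 by norm_num, map_mul, pow_two] at hsq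
  apply eq_of_mul_self_eq_mul_self_withZero
  rw [hsq]
  simp only [mul_assoc, mul_comm, mul_left_comm]

/-! ## §2 (d1)′ The Hensel square root near `1` has depth exactly `|t − 1| ∕ |2|` -/

/-- If `|r − 1| < |2|` then `|r + 1| = |2|` (since `(r + 1) − (r − 1) = 2`). [cite: Omeara1963, §63A 63:1] -/
theorem valued_add_one_eq_valued_two_of_valued_sub_one_lt {K : Type*} [Field K] [Valued K ℤᵐ⁰] (r : K) (h : Valued.v (r - 1) < Valued.v (2 : K)) :
    Valued.v (r + 1) = Valued.v (2 : K) := by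
  have e : r + 1 = 2 + (r - 1) := by ring
  rw [e]
  exact Valuation.map_add_eq_of_lt_left _ h

/-- **EXACT DEPTH OF THE ROOT NEAR `1`**: if `r² = t` and `|r − 1| < |2|` then `|2|·|r − 1| = |t − 1|` (`t − 1 = (r − 1)(r + 1)` and `|r + 1| = |2|`) — the `|2|`-carrying
form of «`|r − 1| = |t − 1|`» of the tame rows. [cite: Omeara1963, §63A 63:1, 63:8] [cite: Serre1979, Ch. XIV §4] -/
theorem valued_two_mul_valued_sub_one_eq_of_sq_eq {K : Type*} [Field K] [Valued K ℤᵐ⁰] {r t : K} (hr : r ^ 2 = t) (h : Valued.v (r - 1) < Valued.v (2 : K)) :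
    Valued.v (2 : K) * Valued.v (r - 1) = Valued.v (t - 1) := by
  have e : t - 1 = (r + 1) * (r - 1) := by rw [← hr]; ring
  rw [e, map_mul, valued_add_one_eq_valued_two_of_valued_sub_one_lt r h]

/-- **THE OTHER ROOT IS EXACTLY `|2|`-DEEP**: if `|r − 1| < |2|` then `|−r − 1| = |2|`. [cite: Omeara1963, §63A 63:1] -/
theorem valued_neg_sub_one_eq_valued_two {K : Type*} [Field K] [Valued K ℤᵐ⁰] (r : K) (h : Valued.v (r - 1) < Valued.v (2 : K)) :
    Valued.v (-r - 1) = Valued.v (2 : K) := by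
  rw [show -r - 1 = -(r + 1) by ring, Valuation.map_neg]
  exact valued_add_one_eq_valued_two_of_valued_sub_one_lt r h

/-- **UNIQUENESS OF THE ROOT NEAR `1`**: two square roots of the same element that are both within `|2|` of `1` coincide (the roots are `±r`, and `−r` is exactly
`|2|`-deep). [cite: Omeara1963, §63A 63:1] -/
theorem eq_of_sq_eq_sq_of_valued_sub_one_lt {K : Type*} [Field K] [Valued K ℤᵐ⁰] {r s : K} (hrs : r ^ 2 = s ^ 2)
    (hr : Valued.v (r - 1) < Valued.v (2 : K)) (hs : Valued.v (s - 1) < Valued.v (2 : K)) : r = s := by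
  have h0 : (r - s) * (r + s) = 0 := by linear_combination hrs
  rcases mul_eq_zero.1 h0 with h | h
  · exact sub_eq_zero.1 h
  · exfalso
    have e : r = -s := by linear_combination h
    rw [e] at hr
    exact (lt_irrefl _) ((valued_neg_sub_one_eq_valued_two s hs) ▸ hr)

/-- **SQUARE ROOTS NEAR `1` WITH THEIR EXACT DEPTH** (strong Hensel for `X² − t` at `1`, every residue characteristic): in a field `K` whose valuation ring `𝒪[K]` is
`𝓂[K]`-adically complete, `|t − 1| < |4| ⇒ ∃ r, r² = t ∧ |r − 1| < |2| ∧ |2|·|r − 1| = |t − 1|` (existence = ★ `LocalFields.exists_mul_self_eq_of_valued_sub_one_lt_four`;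
depth = ★ `valued_two_mul_valued_sub_one_eq_of_sq_eq`).  At a dyadic place this is «`1 + 4𝔭 ⊆ (𝒪^×)²` with the root read to precision `|t − 1|∕|2|`». [cite: Omeara1963, §63A 63:8]
[cite: Serre1979, Ch. XIV §4] -/
theorem exists_sq_eq_and_valued_sub_one_eq_of_valued_sub_one_lt_four {K : Type*} [Field K] [Valued K ℤᵐ⁰] [IsAdicComplete 𝓂[K] 𝒪[K]]
    (t : K) (ht : Valued.v (t - 1) < Valued.v (4 : K)) :
    ∃ r : K, r ^ 2 = t ∧ Valued.v (r - 1) < Valued.v (2 : K) ∧ Valued.v (2 : K) * Valued.v (r - 1) = Valued.v (t - 1) := by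
  obtain ⟨r, hr, hr1⟩ := Literature.NumberTheory.LocalFields.exists_mul_self_eq_of_valued_sub_one_lt_four t ht
  have hr2 : r ^ 2 = t := by rw [pow_two, hr]
  exact ⟨r, hr2, hr1, valued_two_mul_valued_sub_one_eq_of_sq_eq hr2 hr1⟩

/-- **SQUARE ROOTS NEAR `1` WITH THEIR EXACT DEPTH, IN `K_v`** — the completion of a number field `K` at ANY finite place `v` (dyadic included):
`|t − 1| < |4| ⇒ ∃ r, r² = t ∧ |r − 1| < |2| ∧ |2|·|r − 1| = |t − 1|`.  The (D-RAM) rows call it at `K := L`, `v := w.1` (their `hsq` socket, `|2|`-carrying form); the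
instance datum is ★ `isAdicComplete_valuedMaximalIdeal_valuedInteger_adicCompletion`. [cite: Omeara1963, §63A 63:8] [cite: Serre1979, Ch. XIV §4] -/
theorem exists_sq_eq_and_valued_sub_one_eq_of_valued_sub_one_lt_four_adicCompletion (K : Type*) [Field K] [NumberField K]
    (v : HeightOneSpectrum (𝓞 K)) (t : v.adicCompletion K) (ht : Valued.v (t - 1) < Valued.v (4 : v.adicCompletion K)) :
    ∃ r : v.adicCompletion K, r ^ 2 = t ∧ Valued.v (r - 1) < Valued.v (2 : v.adicCompletion K) ∧
      Valued.v (2 : v.adicCompletion K) * Valued.v (r - 1) = Valued.v (t - 1) :=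
  haveI := Literature.NumberTheory.Automorphic.isAdicComplete_valuedMaximalIdeal_valuedInteger_adicCompletion K v
  exists_sq_eq_and_valued_sub_one_eq_of_valued_sub_one_lt_four t ht

end Literature.NumberTheory.NumberFields

end
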